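import Mathlib
import Summits.Ventures.PercRepro2.LeafRowPendantRootMirrorB

/-!
# The second-order mirror (A)-term dominates its pair-avoidance form
(blind cell PercRepro2, p5 g31; `proofs/P5-OEDGE.md` §41)

`crossA′so = 2Z·P(Q,vL,oH,bH) − P(Q,bH)·P(Q,vL,oH) + π_v·P(Q,oH)·P(Q,bH) − P(Q,oH)·P(Q,vL,bH)`
is the one open sign of the pendant-root case of row (LEAF-½) (`LeafRowPendantRootMirrorB`).
Split every `Q`-mass along `v ∈ C₂`: with `Qᵛ = {a₂ ↮ a₁, a₂ ↮ v}` (the pair avoidance) and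
`Zᵛ = P(Q, vH)`, `xᵛ = P(Q, vH, oH)`, `yᵛ = P(Q, vH, bH)` the three `v ∈ C₂` parts, the
`v ∈ C₁` masses live on `Qᵛ` (`v ∈ C₁` and `v ∈ C₂` together contradict `Q`), so

  `crossA′so = crossA′soAvoid + 2·Zᵛ·P(Q,vL,oH,bH) + xᵛ·(π_v·P(Q,bH) − P(Q,vL,bH))
               + yᵛ·(π_v·P(Qᵛ,oH) − P(Qᵛ,vL,oH))`

(**`crossA'so_eq_avoid_add`**, a set-splitting identity), where `crossA′soAvoid` is the same
form with every `Q` replaced by `Qᵛ`.  The two brackets are monotonicity slacks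
(`LeafRowPendantRootFO.slack_nonneg`, for the cluster families `{b ∈ ·}` and `{o ∈ ·, v ∉ ·}`),
so **`crossA'so_nonneg_of_avoid`**: `0 ≤ crossA′soAvoid → 0 ≤ crossA′so`, and the
pendant-root closers of `LeafRowPendantRootMirrorB` take the pair-avoidance form as their
hypothesis (**`B2h_nonneg_pendant_root_of_avoid`**, **`LeafRow_pendant_root_of_avoid`**).
The pair-avoidance form is the natural object of the `v`-exploration (no `v`-bridging of the
two roots, no `v`-mediated growth of `C₂`): it is a statement about the cluster law of `a₂`
under the avoidance of `{a₁, v}`, which is positively associated (BHK06 Thm 1.3).  Nothing in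
this file claims its sign.  Own work; standard axioms.
-/

namespace Summit.Ventures.PercRepro2

open UnionCluster CovForm CovForm.FirstOrder LeafStep LeafHalfCross LeafRowEdgeCubic
  LeafRowFirstOrderA LeafRowPendantRootFO LeafRowPendantRootSO LeafRowPendantRootMirrorB

namespace LeafRowPendantRootAvoid

section Def

variable {V : Type*} {E : Type*} [Fintype E] [DecidableEq E] [DecidableEq V] {R : Type*} [Field R]

/-- The second-order mirror (A)-term in its pair-avoidance form: `crossA′so` with every
`Q = {a₂ ↮ a₁}` replaced by `Qᵛ = {a₂ ↮ a₁, a₂ ↮ v}`: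
`2Zᵛ·P(Qᵛ,vL,oH,bH) − P(Qᵛ,bH)·P(Qᵛ,vL,oH) + π_v·P(Qᵛ,oH)·P(Qᵛ,bH) − P(Qᵛ,oH)·P(Qᵛ,vL,bH)`. -/
noncomputable def crossA'soAvoid (q : E → R) (ends : E → Sym2 V) (o a₁ a₂ v b : V) : R :=
  2 * prob q (avoidAll ends a₂ {a₁, v}) *
      prob q (avoidAll ends a₂ {a₁, v} ∩
        (connEvent ends a₁ v ∩ (connEvent ends a₂ o ∩ connEvent ends a₂ b))) -
    prob q (avoidAll ends a₂ {a₁, v} ∩ connEvent ends a₂ b) *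
      prob q (avoidAll ends a₂ {a₁, v} ∩ (connEvent ends a₁ v ∩ connEvent ends a₂ o)) +
    prob q (connEvent ends a₁ v) * prob q (avoidAll ends a₂ {a₁, v} ∩ connEvent ends a₂ o) *
      prob q (avoidAll ends a₂ {a₁, v} ∩ connEvent ends a₂ b) -
    prob q (avoidAll ends a₂ {a₁, v} ∩ connEvent ends a₂ o) *
      prob q (avoidAll ends a₂ {a₁, v} ∩ (connEvent ends a₁ v ∩ connEvent ends a₂ b))

end Def

section Main

variable {V : Type*} {E : Type*} [Fintype E] [DecidableEq E] [Fintype V] [DecidableEq V]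
  {R : Type*} [Field R] [LinearOrder R] [IsStrictOrderedRing R]
variable (q : E → R) (ends : E → Sym2 V)

omit [Fintype E] [DecidableEq E] [Fintype V] [DecidableEq V] [LinearOrder R]
  [IsStrictOrderedRing R] in
/-- `v ∈ C₂` and `v ∈ C₁` together contradict `Q`: `Q ∩ vH ∩ (vL ∩ X) = ∅`. -/
lemma Q_inter_vH_inter_vL (a₁ a₂ v : V) (X : Set (Config E)) :
    avoidAll ends a₂ {a₁} ∩ (connEvent ends a₂ v ∩ (connEvent ends a₁ v ∩ X)) = ∅ := by
  ext ω
  simp only [Set.mem_inter_iff, mem_avoidAll, Finset.mem_singleton, forall_eq, mem_connEvent,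
    Set.mem_empty_iff_false, iff_false, not_and]
  intro hQ h2 h1 _
  exact hQ (conn_trans h2 (conn_symm h1))

omit [Fintype V] [LinearOrder R] [IsStrictOrderedRing R] in
/-- A `v ∈ C₁` mass is unchanged by the pair avoidance: `P(Qᵛ, vL, X) = P(Q, vL, X)`. -/
lemma prob_avoid_vL (a₁ a₂ v : V) (X : Set (Config E)) :
    prob q (avoidAll ends a₂ {a₁, v} ∩ (connEvent ends a₁ v ∩ X)) =
      prob q (avoidAll ends a₂ {a₁} ∩ (connEvent ends a₁ v ∩ X)) := by
  rw [Set.inter_comm, prob_inter_avoidAll_pair, Q_inter_vH_inter_vL, prob_empty, sub_zero]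

omit [Fintype V] [LinearOrder R] [IsStrictOrderedRing R] in
/-- `P(Qᵛ, X) = P(Q, X) − P(Q, vH, X)`, the pair avoidance as a split along `v ∈ C₂`. -/
lemma prob_avoid_split (a₁ a₂ v : V) (X : Set (Config E)) :
    prob q (avoidAll ends a₂ {a₁, v} ∩ X) =
      prob q (avoidAll ends a₂ {a₁} ∩ X) -
        prob q (avoidAll ends a₂ {a₁} ∩ (connEvent ends a₂ v ∩ X)) := by
  rw [Set.inter_comm, prob_inter_avoidAll_pair]

omit [Fintype E] [DecidableEq E] [Fintype V] [DecidableEq V] [LinearOrder R]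
  [IsStrictOrderedRing R] in
/-- `{b ∈ C₂} = {C₂ ∈ {b ∈ ·}}`. -/
lemma connEvent_eq_clusterIn (a₂ b : V) :
    connEvent ends a₂ b = clusterInEvent ends a₂ {W | b ∈ W} := by
  ext ω
  simp only [mem_connEvent, mem_clusterInEvent, Set.mem_setOf_eq, mem_cluster]

omit [Fintype E] [DecidableEq E] [Fintype V] [LinearOrder R] [IsStrictOrderedRing R] in
/-- `Qᵛ ∩ {o ∈ C₂} = Q ∩ {C₂ ∈ {o ∈ ·, v ∉ ·}}`. -/
lemma avoid_inter_connEvent_eq (a₁ a₂ o v : V) :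
    avoidAll ends a₂ {a₁, v} ∩ connEvent ends a₂ o =
      avoidAll ends a₂ {a₁} ∩ clusterInEvent ends a₂ {W | o ∈ W ∧ v ∉ W} := by
  ext ω
  simp only [Set.mem_inter_iff, mem_avoidAll, Finset.mem_insert, Finset.mem_singleton,
    forall_eq_or_imp, forall_eq, mem_connEvent, mem_clusterInEvent, Set.mem_setOf_eq,
    mem_cluster]
  tauto

omit [Fintype V] [LinearOrder R] [IsStrictOrderedRing R] in
/-- **The splitting identity**: `crossA′so = crossA′soAvoid + 2Zᵛ·P(Q,vL,oH,bH)
+ xᵛ·(π_v·P(Q,bH) − P(Q,vL,bH)) + yᵛ·(π_v·P(Qᵛ,oH) − P(Qᵛ,vL,oH))` with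
`Zᵛ = P(Q,vH)`, `xᵛ = P(Q,vH,oH)`, `yᵛ = P(Q,vH,bH)`. -/
theorem crossA'so_eq_avoid_add (o a₁ a₂ v b : V) :
    crossA'so q ends o a₁ a₂ v b =
      crossA'soAvoid q ends o a₁ a₂ v b +
        2 * prob q (avoidAll ends a₂ {a₁} ∩ connEvent ends a₂ v) *
          prob q (avoidAll ends a₂ {a₁} ∩
            (connEvent ends a₁ v ∩ (connEvent ends a₂ o ∩ connEvent ends a₂ b))) +
        prob q (avoidAll ends a₂ {a₁} ∩ (connEvent ends a₂ v ∩ connEvent ends a₂ o)) *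
          (prob q (connEvent ends a₁ v) * prob q (avoidAll ends a₂ {a₁} ∩ connEvent ends a₂ b) -
            prob q (avoidAll ends a₂ {a₁} ∩ (connEvent ends a₁ v ∩ connEvent ends a₂ b))) +
        prob q (avoidAll ends a₂ {a₁} ∩ (connEvent ends a₂ v ∩ connEvent ends a₂ b)) *
          (prob q (connEvent ends a₁ v) * prob q (avoidAll ends a₂ {a₁, v} ∩ connEvent ends a₂ o) -
            prob q (avoidAll ends a₂ {a₁, v} ∩ (connEvent ends a₁ v ∩ connEvent ends a₂ o))) := by
  unfold crossA'so crossA'soAvoid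
  rw [prob_avoid_vL q ends a₁ a₂ v (connEvent ends a₂ o ∩ connEvent ends a₂ b),
    prob_avoid_vL q ends a₁ a₂ v (connEvent ends a₂ o),
    prob_avoid_vL q ends a₁ a₂ v (connEvent ends a₂ b),
    prob_avoid_split q ends a₁ a₂ v (connEvent ends a₂ o),
    prob_avoid_split q ends a₁ a₂ v (connEvent ends a₂ b),
    prob_avoidAll_pair]
  ring1

omit [Fintype E] [DecidableEq E] [Fintype V] [LinearOrder R] [IsStrictOrderedRing R] in
/-- `Q ∩ ({C₂ ∈ {o ∈ ·, v ∉ ·}} ∩ vL) = Qᵛ ∩ (vL ∩ oH)`. -/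
lemma Q_inter_clusterIn_inter_vL (a₁ a₂ o v : V) :
    avoidAll ends a₂ {a₁} ∩ (clusterInEvent ends a₂ {W | o ∈ W ∧ v ∉ W} ∩ connEvent ends a₁ v) =
      avoidAll ends a₂ {a₁, v} ∩ (connEvent ends a₁ v ∩ connEvent ends a₂ o) := by
  ext ω
  simp only [Set.mem_inter_iff, mem_avoidAll, Finset.mem_insert, Finset.mem_singleton,
    forall_eq_or_imp, forall_eq, mem_connEvent, mem_clusterInEvent, Set.mem_setOf_eq,
    mem_cluster]
  tauto

/-- **`crossA′so ≥ 0` follows from its pair-avoidance form**: the three extra terms of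
`crossA'so_eq_avoid_add` are a probability times a mass and two monotonicity slacks
(`slack_nonneg` for the cluster families `{b ∈ ·}` and `{o ∈ ·, v ∉ ·}`). -/
theorem crossA'so_nonneg_of_avoid (hq : IsProbVec q) (o a₁ a₂ v b : V)
    (h : 0 ≤ crossA'soAvoid q ends o a₁ a₂ v b) :
    0 ≤ crossA'so q ends o a₁ a₂ v b := by
  rw [crossA'so_eq_avoid_add]
  have h1 := slack_nonneg q ends hq a₁ a₂ v {W | b ∈ W}
  rw [← connEvent_eq_clusterIn, Set.inter_comm (connEvent ends a₂ b)] at h1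
  have h2 := slack_nonneg q ends hq a₁ a₂ v {W | o ∈ W ∧ v ∉ W}
  rw [← avoid_inter_connEvent_eq, Q_inter_clusterIn_inter_vL] at h2
  have t1 := mul_nonneg (mul_nonneg (by norm_num : (0 : R) ≤ 2)
    (prob_nonneg hq (avoidAll ends a₂ {a₁} ∩ connEvent ends a₂ v)))
    (prob_nonneg hq (avoidAll ends a₂ {a₁} ∩
      (connEvent ends a₁ v ∩ (connEvent ends a₂ o ∩ connEvent ends a₂ b))))
  have t2 := mul_nonneg
    (prob_nonneg hq (avoidAll ends a₂ {a₁} ∩ (connEvent ends a₂ v ∩ connEvent ends a₂ o)))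
    (sub_nonneg.2 h1)
  have t3 := mul_nonneg
    (prob_nonneg hq (avoidAll ends a₂ {a₁} ∩ (connEvent ends a₂ v ∩ connEvent ends a₂ b)))
    (sub_nonneg.2 h2)
  linarith

end Main

section Assembly

variable {V : Type*} {E : Type*} [Fintype E] [DecidableEq E] [Fintype V] [DecidableEq V]
  {R : Type*} [Field R] [LinearOrder R] [IsStrictOrderedRing R]
variable {ends : E → Sym2 V} {p : E → R} {e : E} {a₂ z : V}

/-- **`B2h ≥ 0` at a pendant root, given the pair-avoidance form of the mirror (A)-term at the
open pin.** -/
theorem B2h_nonneg_pendant_root_of_avoid (hp : IsProbVec p) (he : p e ≠ 1)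
    (hleaf : ∀ f, a₂ ∈ ends f → f = e) (hends : ends e = s(a₂, z)) {o a₁ v b : V}
    (ho : o ≠ a₂) (h1 : a₁ ≠ a₂) (hv : v ≠ a₂) (hb : b ≠ a₂)
    (hA : 0 ≤ crossA'soAvoid (Function.update p e 1) ends o a₁ a₂ v b) :
    0 ≤ B2h p ends o a₁ a₂ v b e :=
  B2h_nonneg_pendant_root_of_crossA'so hp he hleaf hends ho h1 hv hb
    (crossA'so_nonneg_of_avoid _ ends (hp.update e zero_le_one le_rfl) o a₁ a₂ v b hA)

/-- **The degree-one-root contraction of row (LEAF-½) modulo the pair-avoidance form of the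
second-order mirror (A)-term**: the row at the contraction `a₂ := z` and
`0 ≤ crossA′soAvoid` at the open pin give the row at the pendant instance, every weight. -/
theorem LeafRow_pendant_root_of_avoid (hp : IsProbVec p) (hleaf : ∀ f, a₂ ∈ ends f → f = e)
    (hends : ends e = s(a₂, z)) {o a₁ v b : V} (ho : o ≠ a₂) (h1 : a₁ ≠ a₂) (hv : v ≠ a₂)
    (hb : b ≠ a₂) (hrow : LeafRow (Function.update p e 1) ends o a₁ a₂ v b)
    (hA : 0 ≤ crossA'soAvoid (Function.update p e 1) ends o a₁ a₂ v b) :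
    LeafRow p ends o a₁ a₂ v b :=
  LeafRow_pendant_root_of_crossA'so hp hleaf hends ho h1 hv hb hrow
    (crossA'so_nonneg_of_avoid _ ends (hp.update e zero_le_one le_rfl) o a₁ a₂ v b hA)

end Assembly

end LeafRowPendantRootAvoid

end Summit.Ventures.PercRepro2
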